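import Mathlib
import HarnessLib
import HarnessLib.Audit
import Summits.AtomisticToContinuum.Statement
import Literature.Geometry.DiscreteGeometry.KissingPatterns
import Literature.MathematicalPhysics.StatisticalMechanics.BarlowStacking
import HarnessLib.Audit.Status.Attr

/-!
Route: TwoPatternShellLadder

# Route TwoPatternShellLadder — tolerance ladder — 1/20 two-pattern density (shared 12086) plus
vanishing-tolerance strain release closes via the landed Barlow chain

Decomposition node decomp-a2c-lens-1 (gen 0, lens grading / quantitative ladder), child of
FreeSplittingCertificates refining its
residual StrictSplittingRule (stmt-AtomisticToContinuum-12560, graded STRONGER than S). It suffices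
to show X = X1 ∧ X2 glued by the
pure-geometry support TwoPatternRigidity: X1 = ZeroDefectDensity (the SHARED item
stmt-AtomisticToContinuum-12086: along every
Lennard-Jones ground-state sequence the fraction of particles whose rescaled first shell is not
1/20-matched to the fcc OR the hcp
kissing pattern tends to 0) and X2 = StrainRelease (along such a sequence, for every tolerance η ≤
1/100 and radius L, frequently in N
some particle has an L-neighbourhood all of whose shells are η-close to a symmetrically
c-axis-stretched fcc/hcp pattern). The tolerance
ladder: 1/20 fixed (certificate, shared) → η → 0 (elastic release, the one NEW statement) → 0⁺
(compactness rigidity, support; exact case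
landed) → below 10⁻⁴ (polytype selection: LANDED chain periodicWindows_of_barlowWindows →
stub_hullCriterion → crystallization_of_isCrystallizing).
Lean: `ZeroDefectDensity ∧ StrainRelease`

## Assembly
Pure logic: closes h₁ h₂ h₃ h₄ h₅ := h₅ (h₄ h₃ h₁ h₂) (glue.lean, lean check rc 0, axioms
propext/Classical.choice/Quot.sound). The schema-required Assembly item records that the route
closes from the two cruxes and the geometric support alone, the two glue supports being provable now
(GlueCertA.lean) / landed (statement identity checked; full kernel check of the chain awaits the
farm build of the EnvelopeGrid3 modules).

Rationale: WHY THIS LINE. Grading the close-packing content by shell tolerance shows that every existing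
Crystallization route carries one residual asserting close
packing at EVERY tolerance at once (12560 strict splitting ∀ pairs;
SpectralChargeLedger.SummedShellPricing ∀τ; BrittleRungDescent 9206 H → S
whole; HullExactificationCascade landscape gap + nine hull items), while the tree already proves
everything finer than the polytype scale
(PeriodicGivenLayered 11779, periodicWindows_of_barlowWindows, HullCriterion 3243, windowOptimality
13962, crysEnergyLimit 0626) and the exact
two-pattern geometry (HalesDSP_layerPackings_holds; HalesDSP2012 §1.3). So the only fixed-tolerance
statement needed is the weakest one already
filed (12086 at 1/20, BlancLewin2015 §2, arXiv:2107.14020 for the fcc/hcp near-degeneracy Δe = 8e-5)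
and the only new statement is the
vanishing-tolerance elastic release (Theil2006 and FlatleyTheil2015 are the d = 2 / local d = 3
engines; arXiv:2506.22614 is the computer-assisted
phonon instrument). Imported areas: discrete geometry of twelve-neighbour packings (Hales),
geometric rigidity / discrete Korn (Friesecke–James–Müller,
Flatley–Theil) for X2, certified lattice sums for the ladder numbers. What it does that prior routes
do not: it is the common weakening of the
four residuals above (each implies X1 ∧ X2), splits frustration (certificate) from elasticity
(coercivity) so difficulty is distributed, and
files 1 new crux + 1 support instead of 12 items; the negatives 4146 / 15929 (fixed-tolerance
geometric claims) are avoided because the only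
geometric item is the ∃η compactness form.

RANKED CRUXES. #2 ZeroDefectDensity (crux) — SHARED item stmt-AtomisticToContinuum-12086
(HullExactificationCascade (A), verbatim): for every sequence of Lennard-Jones ground states in ℝ³
the fraction of particles whose first shell (other particles within 13/10·dᵢ, dᵢ the
nearest-neighbour distance, rescaled by dᵢ⁻¹) is not 1/20-matched after a linear isometry to
fccKissingPattern or hcpKissingPattern tends to 0. Tags: UNDECIDED (test: fcc∨hcp two-pattern
finite-range certificate at 1/20; instrument b2b/freesplit-r2 re-targeted from H12⋆),
INSTRUMENTABLE, residual-type; implied by 12560, by SummedShellPricing and by LocalBarlowOrder.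
[difficulty: XL] (why it might fail: Positive density of icosahedral / decahedral-axis
(Frank–Kasper) first shells in bulk LJ ground states (LJ13 icosahedron beats the cuboctahedral
cluster locally), or no provable on-average finite-range two-pattern inequality at tolerance 1/20.)
[BlancLewin2015, FlatleyTheil2015, arXiv:2107.14020,
Literature.Barriers.AtomisticToContinuum.IcosahedralClusters,
Literature.Barriers.AtomisticToContinuum.DecahedralSoftShell]
#3 StrainRelease (crux) — NEW. Along every LJ ground-state sequence that is a.e. 1/20-close-packed
(antecedent = the 12086 clause for this sequence), for every 0 < η ≤ 1/100 and every L > 0,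
frequently in N some particle i has every particle within L of it η-GOOD: its shell of relative
positions within 5a/4 is ShellCloseTo η (rotation + η-matching) to the hcp or the fcc kissing
pattern scaled by some a ∈ [3/4, 3/2] and stretched symmetrically along the layer normal (1,1,1) by
some |t| ≤ 1/100. No density, no rate, no polytype, no energy inequality. Tags: UNDECIDED (test:
certified positivity of the relaxed fcc and hcp phonon/elastic forms incl. the c-axis shear family;
d = 2 analogue is Theil2006), IDEA-NEEDED (3D discrete two-well rigidity); implied by 12560 and by
SummedShellPricing. [deps: ZeroDefectDensity] [difficulty: XL] (why it might fail: A ground-state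
family a.e. 1/20-close-packed yet with residual strain ≥ η₀ on every L-ball at all large N
(surface-driven modulation), or 1/20 too coarse for any rigidity estimate to start (5 %-good shells
assembling into a non-Barlow strained network).) [Theil2006, FlatleyTheil2015, arXiv:2506.22614,
BlancLewin2015]
#9 TwoPatternRigidity (support) — Pure discrete geometry (LJ-free): for all δ, R′, ε′ > 0 there are
0 < η ≤ 1/100 and L > 0 such that in every finite δ-separated configuration a particle all of whose
L-neighbours are η-GOOD (as in StrainRelease) has its R′-window two-sidedly ε′-matched, after a
linear isometry, to a window of some Barlow stacking barlowStacking a h s (IsHaggSeq s, a h ∈ (1/2,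
2)). Exact unit-shell case = HalesDSP_layerPackings_holds (LANDED); hcp-only fixed-(a,t) η-case =
shellRigidityHcp_proof (LANDED p148531); new content: mixed fcc/hcp sites with per-site (a,t) in the
compact window, by local constancy of (a,t,axis) across shared cap atoms + compactness. Window check
h = a√(2/3)(1+t) ∈ [0.606, 1.237] ⊂ (1/2, 2). Tag: ATTACKABLE M/L. [difficulty: L] [HalesDSP2012,
Hales2012, p148531]
#9 PatchesGiveBarlowWindows (support) — Glue, PROVED in the node folder (GlueCertA.lean,
patchesGiveBarlowWindows_proof, lean check rc 0, standard axioms): TwoPatternRigidity →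
ZeroDefectDensity → StrainRelease → along every LJ ground-state sequence, for all R > 0 and 0 < ε <
1/4, frequently in N some particle's R-window is two-sidedly ε-matched to a window of a Barlow
stacking with a, h ∈ (1/2, 2) — verbatim the hypothesis hW of the landed
periodicWindows_of_barlowWindows. Uses LennardJonesMinimalDistance_holds for the uniform separation.
[difficulty: provable-now] [BlancLewin2015, Xue1997]
#9 BarlowWindowsCrystallize (support) — COSTUME(cite: LANDED chain), kept as an item only so that
closes is logic: (frequently one Barlow window per scale along every LJ ground-state sequence) →
Crystallization, by crystallization_of_isCrystallizing (Cruxes/LJBarlowRigidity/LandedGlue.lean) ∘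
stub_hullCriterion (HullCriterion 3243, PROVED) ∘ periodicWindows_of_barlowWindows
(Theorems/ChessboardParticlePlanesPeriodicWindowsOfBarlowWindows.lean l.310; hypothesis text matched
mechanically). Strictly weaker entry than LaminarBarlowWindows 14292 (density form). [difficulty:
provable-now] [BlancLewin2015, p148531]

TWO-LAYER PLAN. StrainRelease ⇐ (S1 clean-patch counting at η = 1/20-equivalent from density zero +
minimal distance; provable-now) → (S2 local two-well rigidity: an all-1/20-good L′-ball with L′ ≫ L
whose centre region minimises energy locally is η-good on an L-ball; the IDEA-NEEDED step) →
StrainRelease. TwoPatternRigidity ⇐ (exact mixed-pattern stretched classification by un-stretching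
to HalesDSP_layerPackings_holds) → (compactness upgrade as in p148531) → TwoPatternRigidity.
Fallback rung if StrainRelease-from-1/20 dies: re-rung X1 at 1/100 in the stretched family
(OnePercentClosePacking, typed in the node folder) and X2 from 1/100.

KILL CRITERIA. ZeroDefectDensity refuted (positive density of non-close-packed shells in LJ ground
states, e.g. a Frank–Kasper bulk phase beating hcp) closes the route outright and with it every
two-pattern line (12560, SummedShellPricing, 9206's H). StrainRelease refuted by a structural
argument forces the pivot to the 1/100 rung (both cruxes re-typed at 1/100); refuted at every fixed
tolerance it kills the ladder. TwoPatternRigidity can only die by a window mis-typing (repairable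
support). Mooted if 12560 SSR or LaminarBarlowWindows 14292 is proved (either closes Crystallization
through landed glue).

NOT DECOMPOSED YET. The certificate behind ZeroDefectDensity (finite range R, slack function, LMI
block structure for the fcc ∨ hcp union) — that is the instrument's business and 12086 already
carries a registered skeleton (stub_softKissingOrder). The rigidity constants η(δ,R′,ε′), L and the
fault-sparsity sub-case of StrainRelease below the 10⁻⁵ spacing-relaxation scale are layer-2
children.

CHEAPEST FALSIFIER. For the line as a whole: exhibit ONE periodic configuration with energy per
particle below e_hcp = −0.71756 (LJ units r⁻¹²/12 − r⁻⁶/6) that is not a Barlow stacking — it would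
refute ZeroDefectDensity via windowOptimality. Ran here: lattice sums fcc −0.71748, hcp −0.71756,
bcc −0.68637 (gap 3.1e-2, ratio 400 to the fcc/hcp split), consistent with Bétermin–Šamaj–Travěnec
2021 (hcp minimal among the standard structures); the refuter record of 12086 certifies the 1/20
margins against icosahedral, D5h, bcc and Mackay shells.

NUMBERS. e_fcc = −0.717482 (A6 = 14.4536, A12 = 12.1319), e_hcp = −0.717563 (A6 = 14.4546, A12 =
12.1323), Δ(fcc − hcp) = 8e-5, a⋆ = 0.9712, e_bcc = −0.686374 (Δ = 3.1e-2); tolerance rungs 1/20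
(12086) · 1/100 (fallback) · 1/400 (BrittleRung H) · polytype scale 1e-4 (LANDED); stability
constants B_LJ 14.316ε (Yuhjtman2015) → 12ε, 11.3645ε, 11.2382ε, 9.4377ε kernel-checked
(run/shared/lean/pub/pub-blj/README.md); H12⋆ sitewise LMI certificates at the hcp target
(run/shared/lean/b2b/freesplit-r2/CERT.md).

DEFINITION REQUESTS. None: ShellCloseTo, hcpKissingPattern, fccKissingPattern, intVec,
barlowStacking, IsHaggSeq, IsGroundState, lennardJones all exist (lean check rc 0 of Sketch.lean).

Novelty: Searches (2026-08-30): lit search --hybrid "Lennard-Jones ground state close packing fcc hcp local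
structure rigidity three dimensions" (10 docs; [corpus:paper:arxiv-2107.14020 p.1,8] fcc/hcp lattice
ground states); lit vsearch "neighbourhood of every sphere fcc or hcp kissing configuration then
Barlow stacking" ([corpus:book:hales2012-dense-sphere-packings-blueprint-formal-proofs p.17]); lit
search --hybrid "Flatley Theil face-centered cubic crystallization local minimizers rigidity
estimate" ([corpus:paper:arxiv-2506.22614 p.1,3]; crossref doi:10.1007/s00205-015-0862-1); lit
galaxy search "Lennard-Jones ground state|hexagonal close-packed Lennard-Jones|fcc-hcp energy
difference" --star all (2 rows, none relevant); lit galaxy search "stacking fault energy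
Lennard-Jones|Barlow packings|kissing number twelve" --star all ([galaxy:panama:445250669641767]
Conway–Sloane SPLAG); tree: rg over all 80 Crystallization Theses for fcc∧hcp two-pattern items (23
files; nearest 12086, SummedShellPricing, LocalBarlowOrder, RobustBarlowTemplate 12088,
BarlowLiouville); ledger negatives --problem AtomisticToContinuum (24; Crystallization: 15929,
17253, 4146, 3506).
Nearest prior art found: in tree — HullExactificationCascade (12086 + HcpLandscapeGap +
RobustBarlowTemplate + nine hull items) and SpectralChargeLedger (SummedShellPricing ∀τ +
ShellsToLayers); in print — FlatleyTheil2015 (doi:10.1007/s00205-015-0862-1, local fcc theorem under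
an energy-minimality hypothesis) and HalesDSP2012 §1.3  [refs: 10.1007/s00205-015-0862-1, paper:arxiv-2107.14020, book:hales2012-dense-sphere-packings-blueprint-formal-proofs, paper:arxiv-2506.22614, doi:10.1007/s00205-015-0862-1, FlatleyTheil2015, HalesDSP2012]

Barriers (technique_class: tolerance-ladder, two-pattern-shells, compactness): - technique_class: tolerance-ladder, two-pattern-shells, compactness
- Literature.Barriers.AtomisticToContinuum.IcosahedralClusters: bears on ZeroDefectDensity only (a
positive bulk density of icosahedral shells refutes it); the line does not evade it — the bet,
shared with every two-pattern route, is that five-fold order cannot have positive density in LJ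
ground states (frustration), and the 1/20 margins against the icosahedral shell are certified in the
12086 refuter record.
- Literature.Barriers.AtomisticToContinuum.DecahedralSoftShell: same placement (D5h axis shell is
1/20-far from both patterns per the 12086 record); StrainRelease and TwoPatternRigidity never see
five-fold shells (they quantify over GOOD sites only).
- Literature.Barriers.AtomisticToContinuum.FlexibleKissingArrangements: fixed-tolerance GEOMETRIC
rigidity is false near the jitterbug scale; evaded because the only geometric item is the
∃η(δ,R′,ε′) compactness form and the fixed tolerance 1/20 enters only the LJ-specific density
statement.
- Literature.Barriers.AtomisticToContinuum.NoBVEstimatesMultiDBarrier: does not apply — it blocks BV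
/ L¹ total-variation compactness for multi-dimensional hyperbolic conservation laws (the
HydrodynamicLimit conjunct); the `compactness` token here is Bolzano–Weierstrass over the compact
shell-parameter window [3/4,3/2] × [−1/100,1/100] inside the discrete-geometry lemma
TwoPatternRigidity — no BV, Glimm or L¹-semigroup estimate is claimed anywhere in the route.
- Negati

sub-problem: Crystallization · status: open · opened planner-decomp-a2c-lens-1-g0-0 2026-08-30T01:38:28Z · rev 0 · ledger route-AtomisticToContinuum-TwoPatternShellLadder
GENERATED by the gate from the ledger (D-0016/17). Provers cite these decls: `theorem foo : Summit.AtomisticToContinuum.Crystallization.Theses.TwoPatternShellLadder.<Decl> := …` in Summits/AtomisticToContinuum/Crystallization/Theorems/<Name>.lean.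
-/

namespace Summit.AtomisticToContinuum.Crystallization.Theses.TwoPatternShellLadder

open scoped BigOperators Topology Manifold Classical MeasureTheory ProbabilityTheory Matrix InnerProductSpace ComplexConjugate ContinuousMap
open Filter Set Function TopologicalSpace MeasureTheory

attribute [summit_statement] _root_.Crystallization

/-- item stmt-AtomisticToContinuum-12086 · crux · rank 2 · open · by planner
why it might fail: Positive density of icosahedral / decahedral-axis (Frank–Kasper) first shells in bulk LJ ground states (LJ13 icosahedron beats the cuboctahedral cluster locally), or no provable on-average finite-range two-pattern inequality at tolerance 1/20.
sources: BlancLewin2015, FlatleyTheil2015, arXiv:2107.14020, Literature.Barriers.AtomisticToContinuum.IcosahedralClusters, Literature.Barriers.AtomisticToContinuum.DecahedralSoftShell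
[crux] (A) for every sequence of Lennard-Jones ground states in ℝ³ the fraction of particles whose
rescaled first shell (points within 13/10·d_i, scaled by d_i⁻¹, recentred) is not 1/20-matched after
a linear isometry to fccKissingPattern or hcpKissingPattern tends to 0 (card item H3). Tolerance
FIXED (LJ-hcp has c/a ≠ √(8/3)); no rate, no window matching. [difficulty: XL] -/
@[route_item "route-AtomisticToContinuum-TwoPatternShellLadder", crux]
def ZeroDefectDensity : Prop :=
  ∀ (x : (N : ℕ) → (Fin N → EuclideanSpace ℝ (Fin 3))), (∀ N, Literature.MathematicalPhysics.StatisticalMechanics.IsGroundState Literature.MathematicalPhysics.StatisticalMechanics.lennardJones (x N)) → Filter.Tendsto (fun N : ℕ => (Nat.card {i : Fin N // ¬ (let d : ℝ := sInf ((fun z => dist z (x N i)) '' (Set.range (x N) \ {(x N i)})); let T : Set (EuclideanSpace ℝ (Fin 3)) := {z : EuclideanSpace ℝ (Fin 3) | z ∈ Set.range (x N) ∧ z ≠ (x N i) ∧ dist z (x N i) < 13 / 10 * d}; ∃ A : EuclideanSpace ℝ (Fin 3) →ₗᵢ[ℝ] EuclideanSpace ℝ (Fin 3), (∃ e : ↥T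 ≃ ↥Literature.Geometry.DiscreteGeometry.fccKissingPattern, ∀ t : ↥T, dist (d⁻¹ • ((t : EuclideanSpace ℝ (Fin 3)) - (x N i))) (A ((e t : ↥Literature.Geometry.DiscreteGeometry.fccKissingPattern) : EuclideanSpace ℝ (Fin 3))) ≤ 1 / 20) ∨ (∃ e : ↥T ≃ ↥Literature.Geometry.DiscreteGeometry.hcpKissingPattern, ∀ t : ↥T, dist (d⁻¹ • ((t : EuclideanSpace ℝ (Fin 3)) - (x N i))) (A ((e t : ↥Literature.Geometry.DiscreteGeometry.hcpKissingPattern) : EuclideanSpace ℝ (Fin 3))) ≤ 1 / 20))} : ℝ) / (N : ℝ)) Filter.atTop (nhds (0 : ℝ))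

/-- item stmt-AtomisticToContinuum-24071 · crux · rank 3 · open · by planner
why it might fail: A ground-state family a.e. 1/20-close-packed yet with residual strain ≥ η₀ on every L-ball at all large N (surface-driven modulation), or 1/20 too coarse for any rigidity estimate to start (5 %-good shells assembling into a non-Barlow strained network).
sources: Theil2006, FlatleyTheil2015, arXiv:2506.22614, BlancLewin2015
[crux] NEW. Along every LJ ground-state sequence that is a.e. 1/20-close-packed (antecedent = the
12086 clause for this sequence), for every 0 < η ≤ 1/100 and every L > 0, frequently in N some
particle i has every particle within L of it η-GOOD: its shell of relative positions within 5a/4 is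
ShellCloseTo η (rotation + η-matching) to the hcp or the fcc kissing pattern scaled by some a ∈
[3/4, 3/2] and stretched symmetrically along the layer normal (1,1,1) by some |t| ≤ 1/100. No
density, no rate, no polytype, no energy inequality. Tags: UNDECIDED (test: certified positivity of
the relaxed fcc and hcp phonon/elastic forms incl. the c-axis shear family; d = 2 analogue is
Theil2006), IDEA-NEEDED (3D discrete two-well rigidity); implied by 12560 and by SummedShellPricing.
[deps: ZeroDefectDensity] [difficulty: XL] -/
@[route_item "route-AtomisticToContinuum-TwoPatternShellLadder", crux]
def StrainRelease : Prop :=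
  ∀ x : (N : ℕ) → (Fin N → EuclideanSpace ℝ (Fin 3)), (∀ N, Literature.MathematicalPhysics.StatisticalMechanics.IsGroundState Literature.MathematicalPhysics.StatisticalMechanics.lennardJones (x N)) → Filter.Tendsto (fun N : ℕ => (Nat.card {i : Fin N // ¬ (let d : ℝ := sInf ((fun z => dist z (x N i)) '' (Set.range (x N) \ {(x N i)})); let T : Set (EuclideanSpace ℝ (Fin 3)) := {z : EuclideanSpace ℝ (Fin 3) | z ∈ Set.range (x N) ∧ z ≠ (x N i) ∧ dist z (x N i) < 13 / 10 * d}; ∃ A : EuclideanSpace ℝ (Fin 3) →ₗᵢ[ℝ] EuclideanSpace ℝ (Fin 3), (∃ e : ↥T ≃ ↥Literature.Geometry.DiscreteGeometry.fccKissingPattern, ∀ t : ↥T, dist (d⁻¹ • ((t : EuclideanSpace ℝ (Fin 3)) - (x N i))) (A ((e t : ↥Literature.Geometry.DiscreteGeometry.fccKissingPattern) : EuclideanSpace ℝ (Fin 3))) ≤ 1 / 20) ∨ (∃ e : ↥T ≃ ↥Literature.Geometry.DiscreteGeometry.hcpKissingPattern, ∀ t : ↥T, dist (d⁻¹ • ((t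 : EuclideanSpace ℝ (Fin 3)) - (x N i))) (A ((e t : ↥Literature.Geometry.DiscreteGeometry.hcpKissingPattern) : EuclideanSpace ℝ (Fin 3))) ≤ 1 / 20))} : ℝ) / (N : ℝ)) Filter.atTop (nhds (0 : ℝ)) → ∀ η : ℝ, 0 < η → η ≤ 1 / 100 → ∀ L : ℝ, 0 < L → ∃ᶠ N in Filter.atTop, ∃ i : Fin N, ∀ k : Fin N, dist (x N k) (x N i) ≤ L → (∃ a t : ℝ, 3 / 4 ≤ a ∧ a ≤ 3 / 2 ∧ |t| ≤ 1 / 100 ∧ (Literature.Geometry.DiscreteGeometry.ShellCloseTo η ((Finset.univ.filter fun j => j ≠ k ∧ dist (x N j) (x N k) ≤ 5 * a / 4).image fun j => x N j - x N k) (Literature.Geometry.DiscreteGeometry.hcpKissingPattern.image fun u => a • (u + (t * (u 0 + u 1 + u 2) / 3) • Literature.Geometry.DiscreteGeometry.intVec ![1, 1, 1])) ∨ Literature.Geometry.DiscreteGeometry.ShellCloseTo η ((Finset.univ.filter fun j => j ≠ k ∧ dist (x N j) (x N k) ≤ 5 * a / 4).image fun j => x N j - x N k) (Literature.Geometry.DiscreteGeometry.fccKissingPattern.image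 fun u => a • (u + (t * (u 0 + u 1 + u 2) / 3) • Literature.Geometry.DiscreteGeometry.intVec ![1, 1, 1]))))

/-- item stmt-AtomisticToContinuum-24072 · support · rank 9 · open · by planner
sources: HalesDSP2012, Hales2012, p148531
[support] Pure discrete geometry (LJ-free): for all δ, R′, ε′ > 0 there are 0 < η ≤ 1/100 and L > 0
such that in every finite δ-separated configuration a particle all of whose L-neighbours are η-GOOD
(as in StrainRelease) has its R′-window two-sidedly ε′-matched, after a linear isometry, to a window
of some Barlow stacking barlowStacking a h s (IsHaggSeq s, a h ∈ (1/2, 2)). Exact unit-shell case =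
HalesDSP_layerPackings_holds (LANDED); hcp-only fixed-(a,t) η-case = shellRigidityHcp_proof (LANDED
p148531); new content: mixed fcc/hcp sites with per-site (a,t) in the compact window, by local
constancy of (a,t,axis) across shared cap atoms + compactness. Window check h = a√(2/3)(1+t) ∈
[0.606, 1.237] ⊂ (1/2, 2). Tag: ATTACKABLE M/L. [difficulty: L] -/
@[route_item "route-AtomisticToContinuum-TwoPatternShellLadder", crux]
def TwoPatternRigidity : Prop :=
  ∀ δ R' ε' : ℝ, 0 < δ → 0 < R' → 0 < ε' → ∃ η : ℝ, 0 < η ∧ η ≤ 1 / 100 ∧ ∃ L : ℝ, 0 < L ∧ ∀ (N : ℕ) (x : Fin N → EuclideanSpace ℝ (Fin 3)), (∀ i j, i ≠ j → δ ≤ dist (x i) (x j)) → ∀ i : Fin N, (∀ k : Fin N, dist (x k) (x i) ≤ L → (∃ a t : ℝ, 3 / 4 ≤ a ∧ a ≤ 3 / 2 ∧ |t| ≤ 1 / 100 ∧ (Literature.Geometry.DiscreteGeometry.ShellCloseTo η ((Finset.univ.filter fun j => j ≠ k ∧ dist (x j) (x k) ≤ 5 * a / 4).image fun j => x j - x k)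 (Literature.Geometry.DiscreteGeometry.hcpKissingPattern.image fun u => a • (u + (t * (u 0 + u 1 + u 2) / 3) • Literature.Geometry.DiscreteGeometry.intVec ![1, 1, 1])) ∨ Literature.Geometry.DiscreteGeometry.ShellCloseTo η ((Finset.univ.filter fun j => j ≠ k ∧ dist (x j) (x k) ≤ 5 * a / 4).image fun j => x j - x k) (Literature.Geometry.DiscreteGeometry.fccKissingPattern.image fun u => a • (u + (t * (u 0 + u 1 + u 2) / 3) • Literature.Geometry.DiscreteGeometry.intVec ![1, 1, 1]))))) → ∃ a h : ℝ, 1 / 2 < a ∧ a < 2 ∧ 1 / 2 < h ∧ h < 2 ∧ ∃ s : ℤ → ℤ, Literature.MathematicalPhysics.StatisticalMechanics.IsHaggSeq s ∧ ∃ z ∈ Literature.MathematicalPhysics.StatisticalMechanics.barlowStacking a h s, ∃ A : EuclideanSpace ℝ (Fin 3) →ₗᵢ[ℝ] EuclideanSpace ℝ (Fin 3), (∀ p ∈ Literature.MathematicalPhysics.StatisticalMechanics.barlowStacking a h s, dist p z ≤ R' → ∃ j : Fin N, dist (x j) (x i + A (p - z)) ≤ ε') ∧ (∀ j : Fin N,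 dist (x j) (x i) ≤ R' → ∃ p ∈ Literature.MathematicalPhysics.StatisticalMechanics.barlowStacking a h s, dist (x j) (x i + A (p - z)) ≤ ε')

/-- item stmt-AtomisticToContinuum-24073 · support · rank 9 · open · by planner
sources: BlancLewin2015, Xue1997
[support] Glue, PROVED in the node folder (GlueCertA.lean, patchesGiveBarlowWindows_proof, lean
check rc 0, standard axioms): TwoPatternRigidity → ZeroDefectDensity → StrainRelease → along every
LJ ground-state sequence, for all R > 0 and 0 < ε < 1/4, frequently in N some particle's R-window is
two-sidedly ε-matched to a window of a Barlow stacking with a, h ∈ (1/2, 2) — verbatim the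
hypothesis hW of the landed periodicWindows_of_barlowWindows. Uses LennardJonesMinimalDistance_holds
for the uniform separation. [difficulty: provable-now] -/
@[route_item "route-AtomisticToContinuum-TwoPatternShellLadder", crux]
def PatchesGiveBarlowWindows : Prop :=
  TwoPatternRigidity → ZeroDefectDensity → StrainRelease → ∀ x : (N : ℕ) → (Fin N → EuclideanSpace ℝ (Fin 3)), (∀ N, Literature.MathematicalPhysics.StatisticalMechanics.IsGroundState Literature.MathematicalPhysics.StatisticalMechanics.lennardJones (x N)) → ∀ R ε : ℝ, 0 < R → 0 < ε → ε < 1 / 4 → ∃ᶠ N in Filter.atTop, ∃ (i : Fin N) (a h : ℝ), 1 / 2 < a ∧ a < 2 ∧ 1 / 2 < h ∧ h < 2 ∧ ∃ s : ℤ → ℤ, Literature.MathematicalPhysics.StatisticalMechanics.IsHaggSeq s ∧ ∃ z ∈ Literature.MathematicalPhysics.StatisticalMechanics.barlowStacking a h s, ∃ A : EuclideanSpace ℝ (Fin 3) →ₗᵢ[ℝ] EuclideanSpace ℝ (Fin 3), (∀ p ∈ Literature.MathematicalPhysics.StatisticalMechanics.barlowStacking a h s, dist p z ≤ R → ∃ j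 : Fin N, dist (x N j) (x N i + A (p - z)) ≤ ε) ∧ (∀ j : Fin N, dist (x N j) (x N i) ≤ R → ∃ p ∈ Literature.MathematicalPhysics.StatisticalMechanics.barlowStacking a h s, dist (x N j) (x N i + A (p - z)) ≤ ε)

/-- item stmt-AtomisticToContinuum-24074 · support · rank 9 · open · by planner
sources: BlancLewin2015, p148531
[support] COSTUME(cite: LANDED chain), kept as an item only so that closes is logic: (frequently one
Barlow window per scale along every LJ ground-state sequence) → Crystallization, by
crystallization_of_isCrystallizing (Cruxes/LJBarlowRigidity/LandedGlue.lean) ∘ stub_hullCriterion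
(HullCriterion 3243, PROVED) ∘ periodicWindows_of_barlowWindows
(Theorems/ChessboardParticlePlanesPeriodicWindowsOfBarlowWindows.lean l.310; hypothesis text matched
mechanically). Strictly weaker entry than LaminarBarlowWindows 14292 (density form). [difficulty:
provable-now] -/
@[route_item "route-AtomisticToContinuum-TwoPatternShellLadder", crux]
def BarlowWindowsCrystallize : Prop :=
  (∀ x : (N : ℕ) → (Fin N → EuclideanSpace ℝ (Fin 3)), (∀ N, Literature.MathematicalPhysics.StatisticalMechanics.IsGroundState Literature.MathematicalPhysics.StatisticalMechanics.lennardJones (x N)) → ∀ R ε : ℝ, 0 < R → 0 < ε → ε < 1 / 4 → ∃ᶠ N in Filter.atTop, ∃ (i : Fin N) (a h : ℝ), 1 / 2 < a ∧ a < 2 ∧ 1 / 2 < h ∧ h < 2 ∧ ∃ s : ℤ → ℤ, Literature.MathematicalPhysics.StatisticalMechanics.IsHaggSeq s ∧ ∃ z ∈ Literature.MathematicalPhysics.StatisticalMechanics.barlowStacking a h s, ∃ A : EuclideanSpace ℝ (Fin 3) →ₗᵢ[ℝ] EuclideanSpace ℝ (Fin 3), (∀ p ∈ Literature.MathematicalPhysics.StatisticalMechanics.barlowStacking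 a h s, dist p z ≤ R → ∃ j : Fin N, dist (x N j) (x N i + A (p - z)) ≤ ε) ∧ (∀ j : Fin N, dist (x N j) (x N i) ≤ R → ∃ p ∈ Literature.MathematicalPhysics.StatisticalMechanics.barlowStacking a h s, dist (x N j) (x N i + A (p - z)) ≤ ε)) → _root_.Crystallization

/-- item stmt-AtomisticToContinuum-24075 · assembly · rank 1 · open · by planner
sources: BlancLewin2015
[assembly] ZeroDefectDensity → StrainRelease → TwoPatternRigidity → Crystallization (via the
provable-now glue PatchesGiveBarlowWindows and the landed BarlowWindowsCrystallize; proved in the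
node folder as crystallization_of_cruxes modulo the farm build of the EnvelopeGrid3 chain). -/
@[route_item "route-AtomisticToContinuum-TwoPatternShellLadder"]
def Assembly : Prop :=
  ZeroDefectDensity → StrainRelease → TwoPatternRigidity → _root_.Crystallization

/-! D-0027 §2.1 — DECIDING THEOREM (planner-authored via `route open/edit --closes-file`; by planner-decomp-a2c-lens-1-g0-0 2026-08-30T01:38:28Z):
its hypotheses are this route's items and its conclusion the sub-problem Statement (glue_lint), and it elaborates with this file. -/

@[closes "route-AtomisticToContinuum-TwoPatternShellLadder"] theorem closes (h₁ : ZeroDefectDensity) (h₂ : StrainRelease) (h₃ : TwoPatternRigidity)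
    (h₄ : PatchesGiveBarlowWindows) (h₅ : BarlowWindowsCrystallize) : _root_.Crystallization :=
  h₅ (h₄ h₃ h₁ h₂)

end Summit.AtomisticToContinuum.Crystallization.Theses.TwoPatternShellLadder
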